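import Summits.HubbardSuperconductivity.HubbardSuperconductivity.Theorems.BalabanIRBirComplexStableXYRPositivity
import Summits.HubbardSuperconductivity.HubbardSuperconductivity.Theorems.BalabanIRBirComplexStableXYRSplitGlueR3
import Summits.HubbardSuperconductivity.HubbardSuperconductivity.Theorems.BirComplexStableXY.Negative.WitnessTable
import HarnessLib

/-!
# BalabanIR crux 2R `BirComplexStableXYR` (stmt-HubbardSuperconductivity-14845): the crux is EQUIVALENT to the
# conjunction of its two promoted children `ComplexPositivityR3 ∧ ComplexSliceOrderHalf`

Line `log-concave-core-bounded-phase`, line lead c2 (skeleton S4′, `Cruxes/BirComplexStableXYR/Lines/log_concave_core_bounded_phase.lean`).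
The lead hands the crux back as `promote-stub` with two children, both stated `let`-style in the crux's own vocabulary:

* child 1 (`ComplexPositivityR3`): real-part positivity `0 < Re Z` for window range `r ≥ 3`, `K ≥ K₀(r,B,c₀)`, even
  `L₀ ≤ L ≤ M`;
* child 2 (`ComplexSliceOrderHalf`): the slice-averaged deficit bound at the crux's own threshold,
  `Re ∫ D e^{−A} ≤ ½ Re Z`, `D = L⁻⁴ Σ_{x,y}(1 − cos(θ_{x,0} − θ_{y,0}))`, `r ≥ 2`.

`birComplexStableXYR_iff_children` (registered sub-goal of the same name): **`BirComplexStableXYR ↔ child 1 ∧ child 2`** —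
the split is LOSSLESS.  `→`: the landed hidden positivity `birComplexStableXYR_pos` (`0 < Re Z`, and
`½ ≤ Re ∫ O e^{−A} / Re Z`, whence `Re ∫ D e^{−A} = Re Z − Re ∫ O e^{−A} ≤ ½ Re Z` by the numerator identity
`chiff_integral_sliceObs_eq_sub`, `O = 1 − D` pointwise); `←`: the argument of the landed Theses-free glue `stub_splitGlueHalf` (`…SplitGlueR3`, p120778), inlined through
`sg_core_avg` with `κ = 1/2`.  No definitions. [folklore]
-/

noncomputable section

namespace Summit.HubbardSuperconductivity.HubbardSuperconductivity.Theorems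

open scoped BigOperators ComplexConjugate
open MeasureTheory Literature.Probability.LatticeModels Complex
open Summit.HubbardSuperconductivity.BirComplexStableXYNegative
open Summit.HubbardSuperconductivity.HubbardSuperconductivity.Theses.BalabanIR

section ChildrenIff

variable {r : ℕ}

/-- The numerator identity `∫ O·e^{−A} = Z − ∫ D·e^{−A}` on the cube (`O = 1 − D` pointwise, `sg_sliceObs_eq`;
integrability from (C) with `K, c₀ ≥ 0`). [folklore] -/
theorem chiff_integral_sliceObs_eq_sub {K c₀ : ℝ} (hK : 0 ≤ K) (hc₀ : 0 ≤ c₀) (c : Table r)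
    (hC : ∀ φ : W r → ℝ, c₀ * ∑ w, ∑ w', (1 - Real.cos (φ w - φ w')) ≤ (genF c φ).re)
    (L M : ℕ) [NeZero L] [NeZero M] :
    (∫ θ in cube L M, (((‖∑ x : TorusSite 2 L, Complex.exp (Complex.I * (θ (x, 0) : ℂ))‖ ^ 2 / (L : ℝ) ^ 4 : ℝ)) : ℂ) * Complex.exp (-(action K c L M θ))) =
      partZ K c L M - ∫ θ in cube L M, (((∑ x : TorusSite 2 L, ∑ y : TorusSite 2 L, (1 - Real.cos (θ (x, 0) - θ (y, 0)))) / (L : ℝ) ^ 4 : ℝ) : ℂ) * Complex.exp (-(action K c L M θ)) := by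
  have hwc : Continuous (fun θ : Λ L M → ℝ => Complex.exp (-(action K c L M θ))) := sg_continuous_weight K c (sh L M)
  have hwb : ∀ θ : Λ L M → ℝ, ‖Complex.exp (-(action K c L M θ))‖ ≤ 1 := sg_norm_weight_le_one hK hc₀ c hC (sh L M)
  have hcard : (Fintype.card (TorusSite 2 L) : ℝ) = (L : ℝ) ^ 2 := by simp [TorusSite, ZMod.card]
  have hL : (0 : ℝ) < L := by exact_mod_cast Nat.pos_of_ne_zero (NeZero.ne L)
  have hint1 : Integrable (fun θ : Λ L M → ℝ => (1 : ℂ) * Complex.exp (-(action K c L M θ))) (volume.restrict (cube L M)) :=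
    sg_integrable_mul_weight _ hwc hwb (fun _ => (1 : ℂ)) continuous_const 1 (fun _ => by simp)
  have hint0 : Integrable (fun θ : Λ L M → ℝ => Complex.exp (-(action K c L M θ))) (volume.restrict (cube L M)) := by
    simpa using hint1
  have hintD : Integrable (fun θ : Λ L M → ℝ => (((∑ x : TorusSite 2 L, ∑ y : TorusSite 2 L, (1 - Real.cos (θ (x, 0) - θ (y, 0)))) / (L : ℝ) ^ 4 : ℝ) : ℂ) * Complex.exp (-(action K c L M θ)))
      (volume.restrict (cube L M)) := by
    refine sg_integrable_mul_weight _ hwc hwb _ ?_ 2 (fun θ => ?_)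
    · refine Complex.continuous_ofReal.comp ?_
      refine Continuous.div_const ?_ _
      exact continuous_finsetSum _ fun x _ => continuous_finsetSum _ fun y _ =>
        continuous_const.sub (Real.continuous_cos.comp ((continuous_apply _).sub (continuous_apply _)))
    · have h0 : 0 ≤ (∑ x : TorusSite 2 L, ∑ y : TorusSite 2 L, (1 - Real.cos (θ (x, 0) - θ (y, 0)))) / (L : ℝ) ^ 4 :=
        div_nonneg (Finset.sum_nonneg fun x _ => Finset.sum_nonneg fun y _ =>
          sub_nonneg.2 (Real.cos_le_one _)) (by positivity)
      have h1 : (∑ x : TorusSite 2 L, ∑ y : TorusSite 2 L, (1 - Real.cos (θ (x, 0) - θ (y, 0)))) / (L : ℝ) ^ 4 ≤ 2 := by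
        have hL4 : (0 : ℝ) < (L : ℝ) ^ 4 := by positivity
        rw [div_le_iff₀ hL4]
        calc (∑ x : TorusSite 2 L, ∑ y : TorusSite 2 L, (1 - Real.cos (θ (x, 0) - θ (y, 0))))
            ≤ ∑ _x : TorusSite 2 L, ∑ _y : TorusSite 2 L, (2 : ℝ) :=
              Finset.sum_le_sum fun x _ => Finset.sum_le_sum fun y _ => by
                linarith [Real.neg_one_le_cos (θ (x, 0) - θ (y, 0))]
          _ = 2 * (L : ℝ) ^ 4 := by
              simp only [Finset.sum_const, Finset.card_univ, nsmul_eq_mul, hcard]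
              ring
      rw [Complex.norm_real, Real.norm_eq_abs, abs_of_nonneg h0]
      exact h1
  have hpt : ∀ θ : Λ L M → ℝ, (((‖∑ x : TorusSite 2 L, Complex.exp (Complex.I * (θ (x, 0) : ℂ))‖ ^ 2 / (L : ℝ) ^ 4 : ℝ)) : ℂ) * Complex.exp (-(action K c L M θ)) =
      Complex.exp (-(action K c L M θ)) - (((∑ x : TorusSite 2 L, ∑ y : TorusSite 2 L, (1 - Real.cos (θ (x, 0) - θ (y, 0)))) / (L : ℝ) ^ 4 : ℝ) : ℂ) * Complex.exp (-(action K c L M θ)) := by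
    intro θ
    rw [sg_sliceObs_eq L (fun x => θ (x, 0))]
    push_cast
    ring
  calc (∫ θ in cube L M, (((‖∑ x : TorusSite 2 L, Complex.exp (Complex.I * (θ (x, 0) : ℂ))‖ ^ 2 / (L : ℝ) ^ 4 : ℝ)) : ℂ) * Complex.exp (-(action K c L M θ)))
      = ∫ θ in cube L M, (Complex.exp (-(action K c L M θ)) - (((∑ x : TorusSite 2 L, ∑ y : TorusSite 2 L, (1 - Real.cos (θ (x, 0) - θ (y, 0)))) / (L : ℝ) ^ 4 : ℝ) : ℂ) * Complex.exp (-(action K c L M θ))) :=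
        integral_congr_ae (Filter.Eventually.of_forall fun θ => hpt θ)
    _ = (∫ θ in cube L M, Complex.exp (-(action K c L M θ))) - ∫ θ in cube L M, (((∑ x : TorusSite 2 L, ∑ y : TorusSite 2 L, (1 - Real.cos (θ (x, 0) - θ (y, 0)))) / (L : ℝ) ^ 4 : ℝ) : ℂ) * Complex.exp (-(action K c L M θ)) :=
        integral_sub hint0 hintD
    _ = partZ K c L M - ∫ θ in cube L M, (((∑ x : TorusSite 2 L, ∑ y : TorusSite 2 L, (1 - Real.cos (θ (x, 0) - θ (y, 0)))) / (L : ℝ) ^ 4 : ℝ) : ℂ) * Complex.exp (-(action K c L M θ)) := rfl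

/-- **The crux is equivalent to the conjunction of its two promoted children** (`ComplexPositivityR3`: `r ≥ 3`
real-part positivity; `ComplexSliceOrderHalf`: slice-averaged deficit `≤ ½ Re Z`), both written `let`-style in the
crux's vocabulary.  `→` by hidden positivity (`birComplexStableXYR_pos`) and the numerator identity; `←` by the glue
argument of `stub_splitGlueHalf` (inlined, `sg_core_avg`). [folklore] -/
theorem birComplexStableXYR_iff_children :
    Summit.HubbardSuperconductivity.HubbardSuperconductivity.Theses.BalabanIR.BirComplexStableXYR ↔
    ((∀ (r : ℕ) (B c₀ : ℝ), 3 ≤ r → 0 < c₀ → ∃ K₀ : ℝ, ∃ L₀ : ℕ, ∀ K : ℝ, K₀ ≤ K → ∀ c : ((Fin r × Fin r × Fin r) → ℤ) →₀ ℂ, (∀ n ∈ c.support, ∑ w, n w = 0) → c.sum (fun _ a => a) = 0 → c.sum (fun n a => ‖a‖ * Real.exp (∑ w, |(n w : ℝ)|)) ≤ B → (∀ φ : (Fin r × Fin r × Fin r) → ℝ, c₀ * ∑ w, ∑ w', (1 - Real.cos (φ w - φ w')) ≤ (c.sum (fun n a => a * cexp (I * ((∑ w, (n w : ℝ) * φ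 w : ℝ) : ℂ)))).re) → (∀ n : (Fin r × Fin r × Fin r) → ℤ, c (fun w => n (w.1, w.2.1, Fin.rev w.2.2)) = conj (c (-n))) → (∀ n : (Fin r × Fin r × Fin r) → ℤ, c (fun w => n (Fin.rev w.1, Fin.rev w.2.1, w.2.2)) = c n) → ∀ (L M : ℕ) [NeZero L] [NeZero M], L₀ ≤ L → L ≤ M → Even L → Even M → let sh : (TorusSite 2 L × ZMod M) → (Fin r × Fin r × Fin r) → (TorusSite 2 L × ZMod M) := fun s w => (s.1 + ![((w.1 : ℕ) : ZMod L), ((w.2.1 : ℕ) : ZMod L)], s.2 + ((w.2.2 : ℕ) : ZMod M)); let F := fun (φ : (Fin r × Fin r × Fin r) → ℝ) => c.sum (fun n a => a * cexp (I * ((∑ w, (n w : ℝ) * φ w : ℝ) : ℂ))); let A : ((TorusSite 2 L × ZMod M) → ℝ) → ℂ := fun θ => (K : ℂ) * ∑ s, F (fun w => θ (sh s w)); let cube : Set ((TorusSite 2 L × ZMod M) → ℝ) := Set.pi Set.univ (fun _ => Set.Icc (0:ℝ) (2 * Real.pi)); let Z := ∫ θ in cube, cexp (-(A θ)); 0 <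 Z.re) ∧
     (∀ (r : ℕ) (B c₀ : ℝ), 2 ≤ r → 0 < c₀ → ∃ K₀ : ℝ, ∃ L₀ : ℕ, ∀ K : ℝ, K₀ ≤ K → ∀ c : ((Fin r × Fin r × Fin r) → ℤ) →₀ ℂ, (∀ n ∈ c.support, ∑ w, n w = 0) → c.sum (fun _ a => a) = 0 → c.sum (fun n a => ‖a‖ * Real.exp (∑ w, |(n w : ℝ)|)) ≤ B → (∀ φ : (Fin r × Fin r × Fin r) → ℝ, c₀ * ∑ w, ∑ w', (1 - Real.cos (φ w - φ w')) ≤ (c.sum (fun n a => a * cexp (I * ((∑ w, (n w : ℝ) * φ w : ℝ) : ℂ)))).re) → (∀ n : (Fin r × Fin r × Fin r) → ℤ, c (fun w => n (w.1, w.2.1, Fin.rev w.2.2)) = conj (c (-n))) → (∀ n : (Fin r × Fin r × Fin r) → ℤ, c (fun w => n (Fin.rev w.1, Fin.rev w.2.1, w.2.2)) = c n) → ∀ (L M : ℕ) [NeZero L] [NeZero M], L₀ ≤ L → L ≤ M → Even L → Even M → let sh : (TorusSite 2 L × ZMod M) → (Fin r × Fin r × Fin r) → (TorusSite 2 L ×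 ZMod M) := fun s w => (s.1 + ![((w.1 : ℕ) : ZMod L), ((w.2.1 : ℕ) : ZMod L)], s.2 + ((w.2.2 : ℕ) : ZMod M)); let F := fun (φ : (Fin r × Fin r × Fin r) → ℝ) => c.sum (fun n a => a * cexp (I * ((∑ w, (n w : ℝ) * φ w : ℝ) : ℂ))); let A : ((TorusSite 2 L × ZMod M) → ℝ) → ℂ := fun θ => (K : ℂ) * ∑ s, F (fun w => θ (sh s w)); let cube : Set ((TorusSite 2 L × ZMod M) → ℝ) := Set.pi Set.univ (fun _ => Set.Icc (0:ℝ) (2 * Real.pi)); let Z := ∫ θ in cube, cexp (-(A θ)); (∫ θ in cube, (((∑ x : TorusSite 2 L, ∑ y : TorusSite 2 L, (1 - Real.cos (θ (x, 0) - θ (y, 0)))) / (L : ℝ) ^ 4 : ℝ) : ℂ) * cexp (-(A θ))).re ≤ (1/2 : ℝ) * Z.re)) := by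
  constructor
  · intro h
    refine ⟨?_, ?_⟩
    · intro r B c₀ hr hc₀
      obtain ⟨K₀, L₀, H⟩ := birComplexStableXYR_pos h r B c₀ (by omega) hc₀
      refine ⟨K₀, L₀, ?_⟩
      intro K hK c hU1 hN hA hC hR hP L M _ _ hL0 hLM hLe hMe
      exact (H K hK c hU1 hN hA hC hR hP L M hL0 hLM hLe hMe).1
    · intro r B c₀ hr hc₀
      obtain ⟨K₀, L₀, H⟩ := birComplexStableXYR_pos h r B c₀ hr hc₀
      refine ⟨max K₀ 0, L₀, ?_⟩
      intro K hK c hU1 hN hA hC hR hP L M _ _ hL0 hLM hLe hMe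
      have hK₀ : K₀ ≤ K := le_trans (le_max_left _ _) hK
      have hK0 : 0 ≤ K := le_trans (le_max_right _ _) hK
      have key := H K hK₀ c hU1 hN hA hC hR hP L M hL0 hLM hLe hMe
      dsimp only at key
      obtain ⟨hZpos, -, hhalf⟩ := key
      have hC' : ∀ φ : W r → ℝ, c₀ * ∑ w, ∑ w', (1 - Real.cos (φ w - φ w')) ≤ (genF c φ).re := hC
      have hZpos' : 0 < (partZ K c L M).re := by
        dsimp only [partZ, action, genF, sh, cube]; exact hZpos
      have hhalf' : (1/2 : ℝ) ≤ (∫ θ in cube L M, (((‖∑ x : TorusSite 2 L, Complex.exp (Complex.I * (θ (x, 0) : ℂ))‖ ^ 2 /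
          (L : ℝ) ^ 4 : ℝ)) : ℂ) * Complex.exp (-(action K c L M θ))).re / (partZ K c L M).re := by
        dsimp only [partZ, action, genF, sh, cube]; exact hhalf
      have hid := chiff_integral_sliceObs_eq_sub hK0 hc₀.le c hC' L M
      rw [le_div_iff₀ hZpos'] at hhalf'
      have hfin : (∫ θ in cube L M, (((∑ x : TorusSite 2 L, ∑ y : TorusSite 2 L,
          (1 - Real.cos (θ (x, 0) - θ (y, 0)))) / (L : ℝ) ^ 4 : ℝ) : ℂ) * Complex.exp (-(action K c L M θ))).re ≤
          (1/2 : ℝ) * (partZ K c L M).re := by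
        have hre : (∫ θ in cube L M, (((∑ x : TorusSite 2 L, ∑ y : TorusSite 2 L,
            (1 - Real.cos (θ (x, 0) - θ (y, 0)))) / (L : ℝ) ^ 4 : ℝ) : ℂ) * Complex.exp (-(action K c L M θ))).re =
          (partZ K c L M).re - (∫ θ in cube L M, (((‖∑ x : TorusSite 2 L, Complex.exp (Complex.I * (θ (x, 0) : ℂ))‖ ^ 2 /
            (L : ℝ) ^ 4 : ℝ)) : ℂ) * Complex.exp (-(action K c L M θ))).re := by
          rw [hid, Complex.sub_re]; ring
        rw [hre]
        linarith
      dsimp only [partZ, action, genF, sh, cube] at hfin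
      dsimp only
      exact hfin
  · -- `←`: the glue (same proof as the landed `stub_splitGlueHalf`, p120778, inlined via `sg_core_avg` with `κ = 1/2`)
    rintro ⟨h1, h2⟩
    intro r B c₀ hr hc₀
    have hpos : ∃ K₀ : ℝ, ∃ L₀ : ℕ, ∀ K : ℝ, K₀ ≤ K → ∀ c : ((Fin r × Fin r × Fin r) → ℤ) →₀ ℂ, (∀ n ∈ c.support, ∑ w, n w = 0) → c.sum (fun _ a => a) = 0 → c.sum (fun n a => ‖a‖ * Real.exp (∑ w, |(n w : ℝ)|)) ≤ B → (∀ φ : (Fin r × Fin r × Fin r) → ℝ, c₀ * ∑ w, ∑ w', (1 - Real.cos (φ w - φ w')) ≤ (c.sum (fun n a => a * cexp (I * ((∑ w, (n w : ℝ) * φ w : ℝ) : ℂ)))).re) → (∀ n : (Fin r × Fin r × Fin r) → ℤ, c (fun w => n (w.1, w.2.1, Fin.rev w.2.2)) = conj (c (-n))) → (∀ n : (Fin r × Fin r × Fin r) → ℤ, c (fun w => n (Fin.rev w.1, Fin.rev w.2.1, w.2.2)) = c n) → ∀ (L M : ℕ) [NeZero L] [NeZero M], L₀ ≤ L → L ≤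 M → Even L → Even M → let sh : (TorusSite 2 L × ZMod M) → (Fin r × Fin r × Fin r) → (TorusSite 2 L × ZMod M) := fun s w => (s.1 + ![((w.1 : ℕ) : ZMod L), ((w.2.1 : ℕ) : ZMod L)], s.2 + ((w.2.2 : ℕ) : ZMod M)); let F := fun (φ : (Fin r × Fin r × Fin r) → ℝ) => c.sum (fun n a => a * cexp (I * ((∑ w, (n w : ℝ) * φ w : ℝ) : ℂ))); let A : ((TorusSite 2 L × ZMod M) → ℝ) → ℂ := fun θ => (K : ℂ) * ∑ s, F (fun w => θ (sh s w)); let cube : Set ((TorusSite 2 L × ZMod M) → ℝ) := Set.pi Set.univ (fun _ => Set.Icc (0:ℝ) (2 * Real.pi)); let Z := ∫ θ in cube, cexp (-(A θ)); 0 < Z.re := by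
      rcases (show r = 2 ∨ 3 ≤ r by omega) with rfl | h3r
      · refine ⟨0, 0, ?_⟩
        intro K _ c _ _ _ _ hR _ L M _ _ _ _ _ hM
        have h := birEven_partitionFunction_pos c K L M (timeReflection_functional_of_table 2 c hR) hM
        exact h.1
      · exact h1 r B c₀ h3r hc₀
    obtain ⟨K₅, L₅, H5⟩ := hpos
    obtain ⟨K₆, L₆, H6⟩ := h2 r B c₀ hr hc₀
    refine ⟨max (max K₅ K₆) 0, max L₅ L₆, ?_⟩
    intro K hK c hU1 hN hA hC hR hP L M _ _ hL0 hLM hLe hMe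
    have hK5 : K₅ ≤ K := le_trans (le_trans (le_max_left _ _) (le_max_left _ _)) hK
    have hK6 : K₆ ≤ K := le_trans (le_trans (le_max_right _ _) (le_max_left _ _)) hK
    have hK0 : 0 ≤ K := le_trans (le_max_right _ _) hK
    have hL5 : L₅ ≤ L := le_trans (le_max_left _ _) hL0
    have hL6 : L₆ ≤ L := le_trans (le_max_right _ _) hL0
    have p5 := H5 K hK5 c hU1 hN hA hC hR hP L M hL5 hLM hLe hMe
    have p6 := H6 K hK6 c hU1 hN hA hC hR hP L M hL6 hLM hLe hMe
    have hZreal := partitionFunction_conj_eq_self r c K L M (timeReflection_functional_of_table r c hR)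
    dsimp only at p5 p6 hC hZreal ⊢
    have hZim := Complex.conj_eq_iff_im.mp hZreal
    exact sg_core_avg L M _ (sg_continuous_weight K c _) (sg_norm_weight_le_one hK0 hc₀.le c hC _) le_rfl
      p5 hZim p6

end ChildrenIff

end Summit.HubbardSuperconductivity.HubbardSuperconductivity.Theorems

end
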